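import Mathlib
import HarnessLib
import Literature.NumberTheory.LFunctions.ZetaScrew
import Literature.NumberTheory.LFunctions.ZetaScrewThm41Proofs

/-!
# Route `IntegerScrew` — the HINGE CARRIER of the pivot law (SCREW column, row S-P (P2); RH-FREE)

Suzuki's screw function `Ψ = zetaScrew` (Suzuki2023 (1.1)) is, for `t ≥ 0`, the prime-free «wall
form» `Ψ_wall(t) = 8(cosh(t/2) − 1) − (A/2)t + F(t)` of `ZetaScrewThm41Proofs` MINUS the prime sum
`φ(t) = Σ_{n ≤ e^t} Λ(n) n^{−1/2}(t − log n)` (`zetaScrew_eq_wallPsi_sub_primeSum`; on the wall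
`t < log 2` the prime sum vanishes and this is `zetaScrew_eq_wallPsi`).  The wall form is `C¹` on
`(0, ∞)` with derivative `Ψ₁ = wallPsi₁`; the prime sum is continuous and piecewise affine, with slope
`Σ_{n ≤ N} Λ(n)/√n` on the gap `[log N, log(N+1)]`.  Hence (all RH-free, elementary):

* `hasDerivAt_zetaScrew_of_mem_Ioo` — on every open gap `log N < t < log(N+1)` (`N ≥ 1`),
  `Ψ'(t) = Ψ₁(t) − Σ_{n ≤ N} Λ(n)/√n`;
* `hasDerivWithinAt_zetaScrew_Ici` / `hasDerivWithinAt_zetaScrew_Iic` — at a node `t = log q`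
  (`q ≥ 2`) both one-sided derivatives exist, `Ψ'(log q⁺) = Ψ₁(log q) − Σ_{n ≤ q} Λ(n)/√n` and
  `Ψ'(log q⁻) = Ψ₁(log q) − Σ_{n ≤ q−1} Λ(n)/√n`;
* `derivWithin_zetaScrew_Ici_sub_Iic` — **the hinge: `Ψ'(log q⁺) − Ψ'(log q⁻) = −Λ(q)/√q`**, i.e.
  `Ψ'` drops by `Λ(q) q^{−1/2}` exactly at the prime powers `q` and is continuous across every other
  `log q`.

This is the «hinge sign/carrier» entry of PIVOT-LAW §2d/§10.2 (there DERIVED/IDENTIFIED; here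
THEOREM): the kink of `Ψ` at lag `log q` of size `−Λ(q)q^{−1/2}` is what produces the dipole of the
pivot deficit at `m = ⌈M/q⌉` (the divisor stencil).  LABEL (ladder rule §5.4): RH-FREE — a statement
about the explicit function `Ψ`, no zeros involved; nothing here bears on the truth of RH.
-/

noncomputable section

-- D-0017: `Summit.<S>.<S>.…` is the designed namespace of a single-problem summit.
set_option linter.dupNamespace false

namespace Summit.RiemannHypothesis.RiemannHypothesis.Theorems.IntegerScrew

open Literature.NumberTheory.LFunctions Literature.NumberTheory.LFunctions.Suzuki2023Thm41
open Filter Set Finset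
open scoped Topology BigOperators

/-! ### `Ψ = Ψ_wall − φ` for all `t ≥ 0` -/

/-- For every `t ≥ 0`: `Ψ(t) = Ψ_wall(t) − φ(t)` with `Ψ_wall = wallPsi` (the prime-free part,
`8(cosh(t/2) − 1) − (A/2)t + Σ_k (1 − e^{−λ_k t})/λ_k²`) and `φ = zetaScrewPrimeSum`.  (On the wall
`t < log 2`, `φ = 0` and this is `zetaScrew_eq_wallPsi`.) [cite: Suzuki2023, (1.1)] -/
theorem zetaScrew_eq_wallPsi_sub_primeSum {t : ℝ} (ht : 0 ≤ t) :
    zetaScrew t = wallPsi t - zetaScrewPrimeSum t := by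
  have habs : |t| = t := abs_of_nonneg ht
  rw [zetaScrew_eq, hurwitzLerchQuarter, habs]
  have hcosh : Real.exp (t / 2) + Real.exp (-(t / 2)) - 2 = 2 * (Real.cosh (t / 2) - 1) := by
    rw [Real.cosh_eq]; ring
  rw [hcosh, ← tsum_mul_left, ← (summable_one_div_nat_add_quarter_sq).tsum_sub
    (by simpa [habs] using (summable_hurwitzLerchQuarter t).mul_left (Real.exp (-(t / 2)))),
    ← tsum_mul_left]
  have hterm : ∀ k : ℕ, (1 / 4 : ℝ) * (1 / ((k : ℝ) + 1 / 4) ^ 2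
      - Real.exp (-(t / 2)) * (Real.exp (-(2 * t * k)) / ((k : ℝ) + 1 / 4) ^ 2))
      = (1 - Real.exp (-(lam k * t))) / lam k ^ 2 := by
    intro k
    have hk : (k : ℝ) + 1 / 4 ≠ 0 := by positivity
    have hl : lam k = 2 * ((k : ℝ) + 1 / 4) := by rw [lam]; ring
    have hexp : Real.exp (-(t / 2)) * Real.exp (-(2 * t * k)) = Real.exp (-(lam k * t)) := by
      rw [← Real.exp_add, hl]; ring_nf
    rw [← hexp, hl]
    field_simp
    ring
  simp_rw [hterm]
  rw [wallPsi, wallF, wallSlope]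
  ring

/-! ### The derivative of the wall form on `(0, ∞)` (private re-derivation of the termwise
differentiation of `ZetaScrewThm41Proofs`, whose lemmas are file-private) -/

/-- `λ_k = 2k + 1/2 > 0`. [folklore] -/
private theorem lam_pos' (k : ℕ) : 0 < lam k := by unfold lam; positivity

/-- `λ_k ≥ 1/2`. [folklore] -/
private theorem half_le_lam' (k : ℕ) : 1 / 2 ≤ lam k := by
  unfold lam; linarith [(Nat.cast_nonneg k : (0:ℝ) ≤ k)]

/-- `e^{−λ_k t} = e^{−t/2}·(e^{−2t})^k`. [folklore] -/
private theorem exp_neg_lam_mul' (k : ℕ) (t : ℝ) :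
    Real.exp (-(lam k * t)) = Real.exp (-(t / 2)) * Real.exp (-(2 * t)) ^ k := by
  rw [← Real.exp_nat_mul, ← Real.exp_add, lam]
  ring_nf

/-- `Σ_k e^{−λ_k t}` converges for `t > 0` (geometric). [folklore] -/
private theorem summable_exp_neg_lam_mul' {t : ℝ} (ht : 0 < t) :
    Summable fun k : ℕ => Real.exp (-(lam k * t)) := by
  have hr : Real.exp (-(2 * t)) < 1 := by rw [Real.exp_lt_one_iff]; linarith
  simp_rw [exp_neg_lam_mul']
  exact (summable_geometric_of_lt_one (Real.exp_pos _).le hr).mul_left _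

/-- The terms `(1 − e^{−λ_k t})/λ_k²` of `F` are summable for `t ≥ 0` (dominated by `1/λ_k²`).
[folklore] -/
private theorem summable_wallF_term' {t : ℝ} (ht : 0 ≤ t) :
    Summable fun k : ℕ => (1 - Real.exp (-(lam k * t))) / lam k ^ 2 := by
  refine Suzuki2023Thm42.summable_one_div_lam_sq.of_norm_bounded fun k => ?_
  have hlam := lam_pos' k
  have h1 : Real.exp (-(lam k * t)) ≤ 1 := by
    rw [Real.exp_le_one_iff, neg_nonpos]; positivity
  rw [Real.norm_eq_abs, abs_of_nonneg (div_nonneg (sub_nonneg.2 h1) (by positivity))]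
  unfold lam at *
  exact div_le_div_of_nonneg_right (by linarith [Real.exp_pos (-((2 * (k:ℝ) + 1 / 2) * t))])
    (by positivity)

/-- Termwise derivative: `d/dy (1 − e^{−λ_k y})/λ_k² = e^{−λ_k y}/λ_k`. [folklore] -/
private theorem hasDerivAt_wallF_term' (k : ℕ) (y : ℝ) :
    HasDerivAt (fun y => (1 - Real.exp (-(lam k * y))) / lam k ^ 2)
      (Real.exp (-(lam k * y)) / lam k) y := by
  have hne : lam k ≠ 0 := ne_of_gt (lam_pos' k)
  have h1 : HasDerivAt (fun y => -(lam k * y)) (-(lam k * 1)) y :=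
    ((hasDerivAt_id' y).const_mul (lam k)).fun_neg
  have h2 : HasDerivAt (fun y => Real.exp (-(lam k * y)))
      (Real.exp (-(lam k * y)) * (-(lam k * 1))) y := (Real.hasDerivAt_exp _).comp y h1
  have h3 := ((hasDerivAt_const y (1 : ℝ)).fun_sub h2).div_const (lam k ^ 2)
  refine h3.congr_deriv ?_
  rw [div_eq_div_iff (pow_ne_zero 2 hne) hne]
  ring

/-- `F' = G` on `(0, ∞)` (termwise differentiation, locally uniform domination by
`2e^{−λ_k t/2}`). [folklore] -/
private theorem hasDerivAt_wallF' {t : ℝ} (ht : 0 < t) : HasDerivAt wallF (wallG t) t := by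
  have hδ0 : 0 < t / 2 := by positivity
  have hu : Summable fun k : ℕ => 2 * Real.exp (-(lam k * (t / 2))) :=
    (summable_exp_neg_lam_mul' hδ0).mul_left 2
  have h := hasDerivAt_tsum_of_isPreconnected (𝕜 := ℝ) (F := ℝ) (t := Set.Ioi (t / 2)) (y₀ := t)
    (g := fun (k : ℕ) (y : ℝ) => (1 - Real.exp (-(lam k * y))) / lam k ^ 2)
    (g' := fun (k : ℕ) (y : ℝ) => Real.exp (-(lam k * y)) / lam k) hu isOpen_Ioi
    (convex_Ioi (t / 2)).isPreconnected (fun k y _ => hasDerivAt_wallF_term' k y) ?_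
    (by simp only [Set.mem_Ioi]; linarith) (summable_wallF_term' ht.le) (y := t)
    (by simp only [Set.mem_Ioi]; linarith)
  · exact h
  · intro k y hy
    simp only [Set.mem_Ioi] at hy
    have hlam := lam_pos' k
    have h2 := half_le_lam' k
    rw [Real.norm_eq_abs, abs_of_nonneg (by positivity), div_eq_mul_inv]
    have hexp : Real.exp (-(lam k * y)) ≤ Real.exp (-(lam k * (t / 2))) :=
      Real.exp_le_exp.mpr (by nlinarith)
    have hinv : (lam k)⁻¹ ≤ 2 := by
      rw [inv_le_comm₀ hlam (by norm_num)]; linarith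
    calc Real.exp (-(lam k * y)) * (lam k)⁻¹
        ≤ Real.exp (-(lam k * (t / 2))) * 2 :=
          mul_le_mul hexp hinv (inv_nonneg.mpr hlam.le) (Real.exp_pos _).le
      _ = 2 * Real.exp (-(lam k * (t / 2))) := by ring

/-- `Ψ_wall' = Ψ₁` on `(0, ∞)`: `d/dt [8(cosh(t/2) − 1) − (A/2)t + F(t)] = 4 sinh(t/2) − A/2 + G(t)`
(a public copy of the file-private `hasDerivAt_wallPsi` of `ZetaScrewThm41Proofs`).
[cite: Suzuki2023, proof of Thm 4.1] -/
theorem hasDerivAt_wallPsi_Ioi {t : ℝ} (ht : 0 < t) : HasDerivAt wallPsi (wallPsi₁ t) t := by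
  have hc : HasDerivAt (fun t : ℝ => Real.cosh (t / 2)) (Real.sinh (t / 2) * (1 / 2)) t :=
    ((hasDerivAt_id' t).div_const 2).cosh
  have h1 : HasDerivAt (fun t : ℝ => 8 * (Real.cosh (t / 2) - 1))
      (8 * (Real.sinh (t / 2) * (1 / 2))) t := (hc.sub_const 1).const_mul 8
  have h2 : HasDerivAt (fun t : ℝ => wallSlope / 2 * t) (wallSlope / 2 * 1) t :=
    (hasDerivAt_id' t).const_mul (wallSlope / 2)
  have h := (h1.fun_sub h2).fun_add (hasDerivAt_wallF' ht)
  have e : wallPsi₁ t = 8 * (Real.sinh (t / 2) * (1 / 2)) - wallSlope / 2 * 1 + wallG t := by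
    rw [wallPsi₁]; ring
  rw [e]
  exact h

/-! ### The prime sum on a gap `[log N, log(N+1)]` -/

/-- On the closed gap `log N ≤ t ≤ log(N+1)` (`N ≥ 1`, so `t ≥ 0`) the prime sum is the affine
function `φ(t) = Σ_{n ∈ [1,N]} Λ(n) n^{−1/2} (t − log n)` (the summand `n = N+1`, if present, is
`max(t − log(N+1), 0) = 0`). [folklore] -/
theorem zetaScrewPrimeSum_eq_of_mem_Icc {N : ℕ} (hN : 1 ≤ N) {t : ℝ}
    (h1 : Real.log N ≤ t) (h2 : t ≤ Real.log (N + 1)) :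
    zetaScrewPrimeSum t = ∑ n ∈ Icc 1 N,
      ArithmeticFunction.vonMangoldt n / Real.sqrt n * (t - Real.log n) := by
  have hN0 : (0 : ℝ) < N := by exact_mod_cast hN
  have ht0 : 0 ≤ t := (Real.log_nonneg (by exact_mod_cast hN)).trans h1
  have habs : |t| = t := abs_of_nonneg ht0
  have hM : Real.exp |t| ≤ ((N + 1 : ℕ) : ℝ) := by
    rw [habs]
    have : Real.exp t ≤ Real.exp (Real.log (N + 1)) := Real.exp_le_exp.2 h2
    rwa [Real.exp_log (by positivity), ← Nat.cast_add_one] at this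
  rw [zetaScrewPrimeSum_eq_sum_max hM, habs, Finset.sum_Icc_succ_top (by omega)]
  have htop : max (t - Real.log ((N + 1 : ℕ) : ℝ)) 0 = 0 := by
    rw [max_eq_right]; push_cast; linarith
  rw [htop, mul_zero, add_zero]
  refine Finset.sum_congr rfl fun n hn => ?_
  rw [Finset.mem_Icc] at hn
  have hn0 : (0 : ℝ) < n := by exact_mod_cast hn.1
  have hle : Real.log n ≤ t :=
    (Real.log_le_log hn0 (by exact_mod_cast hn.2)).trans h1
  rw [max_eq_left (sub_nonneg.2 hle)]

/-- On the open gap `log N < t < log(N+1)` (`N ≥ 1`) the prime sum is differentiable with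
`φ'(t) = Σ_{n ≤ N} Λ(n) n^{−1/2}` (the weighted Chebyshev function `ψ_{1/2}(N)`). [folklore] -/
theorem hasDerivAt_zetaScrewPrimeSum {N : ℕ} (hN : 1 ≤ N) {t : ℝ}
    (h1 : Real.log N < t) (h2 : t < Real.log (N + 1)) :
    HasDerivAt zetaScrewPrimeSum
      (∑ n ∈ Icc 1 N, ArithmeticFunction.vonMangoldt n / Real.sqrt n) t := by
  have haff : HasDerivAt (fun t : ℝ => ∑ n ∈ Icc 1 N,
      ArithmeticFunction.vonMangoldt n / Real.sqrt n * (t - Real.log n))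
      (∑ n ∈ Icc 1 N, ArithmeticFunction.vonMangoldt n / Real.sqrt n) t := by
    have := HasDerivAt.fun_sum (u := Icc 1 N) (x := t)
      (A := fun n (t : ℝ) => ArithmeticFunction.vonMangoldt n / Real.sqrt n * (t - Real.log n))
      (A' := fun n => ArithmeticFunction.vonMangoldt n / Real.sqrt n * 1)
      (fun n _ => ((hasDerivAt_id' t).sub_const (Real.log (n : ℝ))).const_mul _)
    simpa using this
  refine haff.congr_of_eventuallyEq ?_
  filter_upwards [Ioo_mem_nhds h1 h2] with x hx
  exact zetaScrewPrimeSum_eq_of_mem_Icc hN hx.1.le hx.2.le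

/-! ### `Ψ'` on the gaps and at the nodes -/

/-- **`Ψ'` between consecutive nodes (RH-free).** For `N ≥ 1` and `log N < t < log(N+1)`:
`Ψ'(t) = Ψ₁(t) − Σ_{n ≤ N} Λ(n)/√n`, `Ψ₁ = wallPsi₁ = 4 sinh(t/2) − A/2 + G(t)`
(closed form of `G` in `wallG_eq_closedForm`). [cite: Suzuki2023, (1.1)] -/
theorem hasDerivAt_zetaScrew_of_mem_Ioo {N : ℕ} (hN : 1 ≤ N) {t : ℝ}
    (h1 : Real.log N < t) (h2 : t < Real.log (N + 1)) :
    HasDerivAt zetaScrew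
      (wallPsi₁ t - ∑ n ∈ Icc 1 N, ArithmeticFunction.vonMangoldt n / Real.sqrt n) t := by
  have ht0 : 0 < t := (Real.log_nonneg (by exact_mod_cast hN)).trans_lt h1
  have h := (hasDerivAt_wallPsi_Ioi ht0).sub (hasDerivAt_zetaScrewPrimeSum hN h1 h2)
  refine h.congr_of_eventuallyEq ?_
  filter_upwards [Ioi_mem_nhds ht0] with x hx
  exact zetaScrew_eq_wallPsi_sub_primeSum (le_of_lt hx)

/-- The affine branch `Ψ_wall − Σ_{n ≤ N} Λ(n)n^{−1/2}(· − log n)` has derivative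
`Ψ₁(t) − Σ_{n ≤ N} Λ(n)/√n` at every `t > 0`. [folklore] -/
theorem hasDerivAt_branch (N : ℕ) {t : ℝ} (ht : 0 < t) :
    HasDerivAt (fun t : ℝ => wallPsi t - ∑ n ∈ Icc 1 N,
        ArithmeticFunction.vonMangoldt n / Real.sqrt n * (t - Real.log n))
      (wallPsi₁ t - ∑ n ∈ Icc 1 N, ArithmeticFunction.vonMangoldt n / Real.sqrt n) t := by
  have haff : HasDerivAt (fun t : ℝ => ∑ n ∈ Icc 1 N,
      ArithmeticFunction.vonMangoldt n / Real.sqrt n * (t - Real.log n))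
      (∑ n ∈ Icc 1 N, ArithmeticFunction.vonMangoldt n / Real.sqrt n) t := by
    have := HasDerivAt.fun_sum (u := Icc 1 N) (x := t)
      (A := fun n (t : ℝ) => ArithmeticFunction.vonMangoldt n / Real.sqrt n * (t - Real.log n))
      (A' := fun n => ArithmeticFunction.vonMangoldt n / Real.sqrt n * 1)
      (fun n _ => ((hasDerivAt_id' t).sub_const (Real.log (n : ℝ))).const_mul _)
    simpa using this
  exact (hasDerivAt_wallPsi_Ioi ht).sub haff

/-- **Right derivative at a node (RH-free).** For `q ≥ 2`, `Ψ` restricted to `[log q, ∞)` is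
differentiable at `log q` with `Ψ'(log q⁺) = Ψ₁(log q) − Σ_{n ≤ q} Λ(n)/√n`. [cite: Suzuki2023, (1.1)] -/
theorem hasDerivWithinAt_zetaScrew_Ici {q : ℕ} (hq : 2 ≤ q) :
    HasDerivWithinAt zetaScrew
      (wallPsi₁ (Real.log q) - ∑ n ∈ Icc 1 q, ArithmeticFunction.vonMangoldt n / Real.sqrt n)
      (Ici (Real.log q)) (Real.log q) := by
  have hq1 : (1 : ℝ) < q := by exact_mod_cast hq
  have hlog0 : 0 < Real.log q := Real.log_pos hq1
  have hlt : Real.log q < Real.log (q + 1) := Real.log_lt_log (by positivity) (by linarith)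
  refine ((hasDerivAt_branch q hlog0).hasDerivWithinAt).congr_of_eventuallyEq ?_ ?_
  · have hmem : Set.Ico (Real.log q) (Real.log (q + 1)) ∈ 𝓝[Set.Ici (Real.log q)] (Real.log q) :=
      inter_mem self_mem_nhdsWithin (nhdsWithin_le_nhds <| Iio_mem_nhds hlt)
    filter_upwards [hmem] with x hx
    rw [zetaScrew_eq_wallPsi_sub_primeSum (hlog0.le.trans hx.1),
      zetaScrewPrimeSum_eq_of_mem_Icc (by omega) hx.1 hx.2.le]
  · rw [zetaScrew_eq_wallPsi_sub_primeSum hlog0.le,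
      zetaScrewPrimeSum_eq_of_mem_Icc (by omega) le_rfl hlt.le]

/-- **Left derivative at a node (RH-free).** For `q ≥ 2`, `Ψ` restricted to `(−∞, log q]` is
differentiable at `log q` with `Ψ'(log q⁻) = Ψ₁(log q) − Σ_{n ≤ q−1} Λ(n)/√n` (on
`[log(q−1), log q]` the prime sum is the branch with `N = q − 1`, the `n = q` summand vanishing at
`t = log q`). [cite: Suzuki2023, (1.1)] -/
theorem hasDerivWithinAt_zetaScrew_Iic {q : ℕ} (hq : 2 ≤ q) :
    HasDerivWithinAt zetaScrew
      (wallPsi₁ (Real.log q) - ∑ n ∈ Icc 1 (q - 1), ArithmeticFunction.vonMangoldt n / Real.sqrt n)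
      (Iic (Real.log q)) (Real.log q) := by
  have hq1 : (1 : ℝ) < q := by exact_mod_cast hq
  have hq2 : (2 : ℝ) ≤ q := by exact_mod_cast hq
  have hlog0 : 0 < Real.log q := Real.log_pos hq1
  have hq1' : 1 ≤ q - 1 := by omega
  have hcast : ((q - 1 : ℕ) : ℝ) = (q : ℝ) - 1 := by
    rw [Nat.cast_sub (by omega)]; simp
  have hcast' : ((q - 1 : ℕ) : ℝ) + 1 = (q : ℝ) := by rw [hcast]; ring
  have hpos : (0 : ℝ) < ((q - 1 : ℕ) : ℝ) := by rw [hcast]; linarith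
  have hlt : Real.log ((q - 1 : ℕ) : ℝ) < Real.log q :=
    Real.log_lt_log hpos (by rw [hcast]; linarith)
  refine ((hasDerivAt_branch (q - 1) hlog0).hasDerivWithinAt).congr_of_eventuallyEq ?_ ?_
  · filter_upwards [Ioc_mem_nhdsLE hlt] with x hx
    have hx0 : 0 ≤ x := (Real.log_nonneg (by rw [hcast]; linarith)).trans hx.1.le
    rw [zetaScrew_eq_wallPsi_sub_primeSum hx0,
      zetaScrewPrimeSum_eq_of_mem_Icc hq1' hx.1.le (by rw [hcast']; exact hx.2)]
  · rw [zetaScrew_eq_wallPsi_sub_primeSum hlog0.le,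
      zetaScrewPrimeSum_eq_of_mem_Icc hq1' hlt.le (by rw [hcast'])]

/-- **THE HINGE (RH-free): the jump of `Ψ'` at `t = log q` is `−Λ(q) q^{−1/2}`.**  For every
`q ≥ 2`: `Ψ'(log q⁺) − Ψ'(log q⁻) = −Λ(q)/√q`; in particular `Ψ'` is continuous across `log q`
unless `q` is a prime power.  (The one-sided derivatives are the `derivWithin` on `Ici`/`Iic`, well
defined by `uniqueDiffOn_Ici/Iic`.) [cite: Suzuki2023, (1.1)] -/
theorem derivWithin_zetaScrew_Ici_sub_Iic {q : ℕ} (hq : 2 ≤ q) :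
    derivWithin zetaScrew (Ici (Real.log q)) (Real.log q)
      - derivWithin zetaScrew (Iic (Real.log q)) (Real.log q)
      = -(ArithmeticFunction.vonMangoldt q / Real.sqrt q) := by
  rw [(hasDerivWithinAt_zetaScrew_Ici hq).derivWithin
      (uniqueDiffOn_Ici (Real.log q) _ Set.self_mem_Ici),
    (hasDerivWithinAt_zetaScrew_Iic hq).derivWithin
      (uniqueDiffOn_Iic (Real.log q) _ Set.self_mem_Iic)]
  have hsplit : ∑ n ∈ Icc 1 q, ArithmeticFunction.vonMangoldt n / Real.sqrt n
      = (∑ n ∈ Icc 1 (q - 1), ArithmeticFunction.vonMangoldt n / Real.sqrt n)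
        + ArithmeticFunction.vonMangoldt q / Real.sqrt q := by
    have h : Finset.Icc 1 q = insert q (Finset.Icc 1 (q - 1)) := by
      ext n; simp only [Finset.mem_insert, Finset.mem_Icc]; omega
    rw [h, Finset.sum_insert (by simp; omega), add_comm]
  rw [hsplit]
  ring

/-- The hinge in slope form: the slope of the prime sum increases by exactly `Λ(q)/√q` at `log q`
(`0` unless `q` is a prime power), for every `q ≥ 1`. [folklore] -/
theorem primeSum_slope_succ (q : ℕ) :
    (∑ n ∈ Icc 1 (q + 1), ArithmeticFunction.vonMangoldt n / Real.sqrt n)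
      - (∑ n ∈ Icc 1 q, ArithmeticFunction.vonMangoldt n / Real.sqrt n)
      = ArithmeticFunction.vonMangoldt (q + 1) / Real.sqrt (q + 1 : ℕ) := by
  rw [Finset.sum_Icc_succ_top (by omega)]
  ring

end Summit.RiemannHypothesis.RiemannHypothesis.Theorems.IntegerScrew
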